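import Summits.QuantumFields.YangMills.Theorems.AlphaInputsT3ACv2
import HarnessLib

/-!
# `AlphaInputsT3ACv2Rec` — the version-2 (α) socket at GIVEN [Balaban1985Variational] constants (`OfV2At F 𝔠 a₀ a₁`) and the
# RECORD-PARAMETRIC closed proposition the route's lines name (`AlphaInputsT3ACv2Rec L`, owner RULING g17-№1 §D(3)): «for all sufficiently large
# profiles (b₀, p₀) there is a record with EXACTLY that p-function — and family-UNIFORM constants a₀, a₁ — whose v2 package holds for every family»

Lane `pub-balaban3d`, seat alpha-1 (route owner RULING g17-№1, `pub/ym3-torus/route-R3/ym/plan-g17/OWNER-RULING-g17-1.md` §C STUB 2′ / §D(3)).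
WHY a second layer.  `AlphaInputsT3AC.OfV2 F 𝔠` (previous file) binds the [7] constants `a₀, a₁` by an `∃` INSIDE the family `F`; the adapter stub
(19201 STUB 3′ / 18916 STUB 2′) chooses its regularity window `ε₁(𝔠)` BEFORE `∀ F` and needs `ε₀ ≤ a₀` at EVERY family of block size `L` — print's
constants «depend on d and L only» ([Balaban1985Variational] Thm 1), so the closed Prop must bind `(𝔠, a₀, a₁)` before `∀ F` (seat finding F-α1-8:
with per-family constants no `ε₁(𝔠)` serves all volumes).  THIS FILE: `OfV2At F 𝔠 a₀ a₁` (= `OfV2`'s body at given constants; `OfV2 ↔ ∃ a₀ a₁, consts ∧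
OfV2At`), `AlphaInputsT3ACv2Rec L := ∃ b₁ p₁, ∀ b₀ ≥ b₁, p₀ ≥ p₁, ∃ 𝔠 a₀ a₁, 𝔠.b₀ = b₀ ∧ 𝔠.p₀ = p₀ ∧ consts ∧ ∀ F (hF), OfV2At F (hF ▸ 𝔠) a₀ a₁`
(the owner's literal shape with `OfV2` is the corollary `AlphaInputsT3ACv2Rec.literal`), the record `OfV2At.pkgAtV2` CARRYING THE GIVEN CONSTANTS
(`pkgAtV2_a₀ : (…).a₀ = a₀`), and projections to `OfV2` / v1.  The datum and its delivered schemas at given constants: `AlphaInputsT3ACv2RecData`.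
Hypothesis schemas and bookkeeping; nothing of [Balaban1985UV3]/[Balaban1985Variational] is asserted.

References: T. Bałaban, Commun. Math. Phys. 102 (1985) 255–275 [Balaban1985UV3], Thm 2 p.272, (7) p.257; Commun. Math. Phys. 102 (1985) 277–309
[Balaban1985Variational], Thm 1 (6)–(8) p.279.
-/

set_option autoImplicit false

noncomputable section

namespace Summit.QuantumFields.YangMills.Theorems

open MeasureTheory
open Literature.MathematicalPhysics.QuantumFieldTheory.Balaban1983to89
open Literature.MathematicalPhysics.QuantumFieldTheory.Balaban1983to89.T3ContinuumYM3Torus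
open Literature.MathematicalPhysics.QuantumFieldTheory.Balaban1985CMP102
open Literature.MathematicalPhysics.QuantumFieldTheory.Balaban1985CMP102.Setting
open Summit.QuantumFields.Balaban3D.Carriers
open Summit.QuantumFields.Balaban3D.Proofs.Primitives
open Summit.QuantumFields.Balaban3D.Proofs.GroupModelLieC (lieC)
open Summit.QuantumFields.Balaban3D.Proofs.StandardAC
open Summit.QuantumFields.Balaban3D.Proofs.InputsAC
open Summit.QuantumFields.Balaban3D.Proofs.AlphaAC

/-! ## §1 The v2 package at given constants -/

/-- **(α) AT THE T³ OBJECTS, VERSION 2, AT GIVEN [7] CONSTANTS `a₀, a₁`** (hypothesis schema, never asserted): for every coupling in the window and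
every `K`, minimizer data, expansion data and auxiliary data with the AC (α) rows, the minimiser rows `MinimiserRowsT3 … a₀ a₁ K UkH` and the terminal
rows — `AlphaInputsT3AC.OfV2`'s body with the constants as PARAMETERS (so that they can be bound uniformly in the family).
[cite: Balaban1985UV3, Thm 2 p.272; Balaban1985Variational, Thm 1 (8) p.279] -/
def AlphaInputsT3AC.OfV2At (F : T3Family) (𝔠 : AlphaConsts F.L (suGroupModel 2).N) (a₀ a₁ : ℝ) : Prop :=
  ∀ (γ : ℝ) (hγ : 0 < γ) (hγ1 : γ ≤ (min 𝔠.gamma0 1) ^ 2) (K : ℕ),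
    ∃ (reg : ℕ → Set (GaugeField (F.P K) 0 (Matrix.specialUnitaryGroup (Fin 2) ℂ)))
      (Uk : (k : ℕ) → GaugeField (F.P K) (k + 1) (Matrix.specialUnitaryGroup (Fin 2) ℂ) →
        GaugeField (F.P K) 0 (Matrix.specialUnitaryGroup (Fin 2) ℂ))
      (UkH : (k : ℕ) → Hist (F.P K) k → GaugeField (F.P K) k (Matrix.specialUnitaryGroup (Fin 2) ℂ) →
        GaugeField (F.P K) 0 (Matrix.specialUnitaryGroup (Fin 2) ℂ))
      (hU0 : ∀ V : GaugeField (F.P K) 0 (Matrix.specialUnitaryGroup (Fin 2) ℂ), UkH 0 (Hist.triv (F.P K) 0) V = V)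
      (hUs : ∀ (k : ℕ) (V : GaugeField (F.P K) (k + 1) (Matrix.specialUnitaryGroup (Fin 2) ℂ)),
        UkH (k + 1) (Hist.triv (F.P K) (k + 1)) V = Uk k V)
      (𝔖 : ∀ k, StepSeries (T3Scales F γ hγ (hγ1.trans (sq_min_one_le _ 𝔠.gamma0_pos)) K)
        (Matrix.specialUnitaryGroup (Fin 2) ℂ) ↥(lieC (suGroupModel 2))
        (nblkOf (T3Scales F γ hγ (hγ1.trans (sq_min_one_le _ 𝔠.gamma0_pos)) K) 𝔠.lane.carrier k) k)
      (𝔄 : AlphaDataAC (suGroupModel 2) 𝔠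
        (XT3 F γ hγ (hγ1.trans (sq_min_one_le _ 𝔠.gamma0_pos)) K reg Uk UkH hU0 hUs) 𝔖),
      RunAlphaAC (suGroupModel 2) 𝔠 (XT3 F γ hγ (hγ1.trans (sq_min_one_le _ 𝔠.gamma0_pos)) K reg Uk UkH hU0 hUs) 𝔖 𝔄 ∧
        MinimiserRowsT3 F 𝔠 γ hγ hγ1 a₀ a₁ K UkH ∧
          TerminalRowsT3 F 𝔠 γ hγ hγ1 K (XT3 F γ hγ (hγ1.trans (sq_min_one_le _ 𝔠.gamma0_pos)) K reg Uk UkH hU0 hUs) 𝔖 (𝔄.cP K)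

variable {F : T3Family} {𝔠 : AlphaConsts F.L (suGroupModel 2).N} {a₀ a₁ : ℝ}

/-- Given constants ⇒ the ∃-form. [cite: Balaban1985Variational, Thm 1 (8) p.279] -/
theorem AlphaInputsT3AC.OfV2At.toOfV2 (h : AlphaInputsT3AC.OfV2At F 𝔠 a₀ a₁) (h0 : 0 < a₀) (h1 : 0 < a₁) (hw : 𝔠.B₃ * a₁ ≤ a₀) :
    AlphaInputsT3AC.OfV2 F 𝔠 :=
  ⟨a₀, a₁, h0, h1, hw, h⟩

/-- Given constants ⇒ v1. [cite: Balaban1985UV3, Thm 2 p.272] -/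
theorem AlphaInputsT3AC.OfV2At.toOf (h : AlphaInputsT3AC.OfV2At F 𝔠 a₀ a₁) (h0 : 0 < a₀) (h1 : 0 < a₁) (hw : 𝔠.B₃ * a₁ ≤ a₀) :
    AlphaInputsT3AC.Of F 𝔠 :=
  (h.toOfV2 h0 h1 hw).toOf

/-- The ∃-form unfolds to SOME constants. [cite: Balaban1985Variational, Thm 1 (8) p.279] -/
theorem AlphaInputsT3AC.OfV2.exists_at (h : AlphaInputsT3AC.OfV2 F 𝔠) :
    ∃ a₀ a₁ : ℝ, 0 < a₀ ∧ 0 < a₁ ∧ 𝔠.B₃ * a₁ ≤ a₀ ∧ AlphaInputsT3AC.OfV2At F 𝔠 a₀ a₁ := h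

/-! ## §2 The record-parametric closed proposition -/

/-- **`AlphaInputsT3ACv2Rec L` — THE RECORD-PARAMETRIC v2 SOCKET** (owner RULING g17-№1 §D(3), STUB 2′'s conclusion): there are thresholds
`b₁, p₁` such that for every profile `(b₀, p₀)` beyond them there is a primitive-constants record `𝔠` with EXACTLY that p-function (`𝔠.b₀ = b₀`,
`𝔠.p₀ = p₀` — the route's windows `θBal(b₀, p₀, ·)` are then the record's own) and [Balaban1985Variational] constants `a₀, a₁` («depend on d and L
only»: bound BEFORE the family), such that the v2 package holds at those constants for EVERY three-torus family of block size `L`.  Print (7) p.257: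
«p(g) = b₀(1 + log g⁻¹)^{p₀}, p₀ > 2 and b₀ is a sufficiently large absolute constant».  OPEN, never asserted. [cite: Balaban1985UV3, (7) p.257 and Thm 2 p.272; Balaban1985Variational, Thm 1 (8) p.279] -/
def AlphaInputsT3ACv2Rec (L : ℕ) : Prop :=
  ∃ (b₁ p₁ : ℝ), ∀ (b₀ p₀ : ℝ), b₁ ≤ b₀ → p₁ ≤ p₀ →
    ∃ (𝔠 : AlphaConsts L (suGroupModel 2).N) (a₀ a₁ : ℝ), 𝔠.b₀ = b₀ ∧ 𝔠.p₀ = p₀ ∧ 0 < a₀ ∧ 0 < a₁ ∧ 𝔠.B₃ * a₁ ≤ a₀ ∧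
      ∀ (F : T3Family) (hF : F.L = L), AlphaInputsT3AC.OfV2At F (hF ▸ 𝔠) a₀ a₁

/-- Unfolding lemma. -/
theorem alphaInputsT3ACv2Rec_iff (L : ℕ) :
    AlphaInputsT3ACv2Rec L ↔ ∃ (b₁ p₁ : ℝ), ∀ (b₀ p₀ : ℝ), b₁ ≤ b₀ → p₁ ≤ p₀ →
      ∃ (𝔠 : AlphaConsts L (suGroupModel 2).N) (a₀ a₁ : ℝ), 𝔠.b₀ = b₀ ∧ 𝔠.p₀ = p₀ ∧ 0 < a₀ ∧ 0 < a₁ ∧ 𝔠.B₃ * a₁ ≤ a₀ ∧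
        ∀ (F : T3Family) (hF : F.L = L), AlphaInputsT3AC.OfV2At F (hF ▸ 𝔠) a₀ a₁ :=
  Iff.rfl

/-- **THE OWNER'S LITERAL SHAPE AS A COROLLARY**: `∃ b₁ p₁, ∀ b₀ ≥ b₁, p₀ ≥ p₁, ∃ 𝔠, 𝔠.b₀ = b₀ ∧ 𝔠.p₀ = p₀ ∧ ∀ F hF, OfV2 F (hF ▸ 𝔠)` (constants
re-absorbed into `OfV2`'s `∃`). [cite: Balaban1985UV3, Thm 2 p.272] -/
theorem AlphaInputsT3ACv2Rec.literal {L : ℕ} (h : AlphaInputsT3ACv2Rec L) :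
    ∃ (b₁ p₁ : ℝ), ∀ (b₀ p₀ : ℝ), b₁ ≤ b₀ → p₁ ≤ p₀ →
      ∃ 𝔠 : AlphaConsts L (suGroupModel 2).N, 𝔠.b₀ = b₀ ∧ 𝔠.p₀ = p₀ ∧
        ∀ (F : T3Family) (hF : F.L = L), AlphaInputsT3AC.OfV2 F (hF ▸ 𝔠) := by
  obtain ⟨b₁, p₁, hrec⟩ := h
  refine ⟨b₁, p₁, fun b₀ p₀ hb hp => ?_⟩
  obtain ⟨𝔠, a₀, a₁, hcb, hcp, h0, h1, hw, hall⟩ := hrec b₀ p₀ hb hp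
  refine ⟨𝔠, hcb, hcp, fun F hF => ?_⟩
  have h2 := hall F hF
  subst hF
  exact h2.toOfV2 h0 h1 hw

/-- **Rec ⇒ v2 at a block size** (one record suffices for `AlphaInputsT3ACv2 L`; take the profile at the thresholds). [cite: Balaban1985UV3, Thm 2 p.272] -/
theorem AlphaInputsT3ACv2Rec.toV2 {L : ℕ} (h : AlphaInputsT3ACv2Rec L) : AlphaInputsT3ACv2 L := by
  obtain ⟨b₁, p₁, hlit⟩ := h.literal
  obtain ⟨𝔠, -, -, h𝔠⟩ := hlit b₁ p₁ le_rfl le_rfl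
  exact ⟨𝔠, h𝔠⟩

/-- **Rec ⇒ v1 at a block size.** [cite: Balaban1985UV3, Thm 2 p.272] -/
theorem AlphaInputsT3ACv2Rec.toV1 {L : ℕ} (h : AlphaInputsT3ACv2Rec L) : AlphaInputsT3AC L :=
  h.toV2.toV1

/-! ## §3 The package's data at `(γ, K)` carrying the GIVEN constants -/

section Pkg

/-- At given constants the v2 record exists with `a₀, a₁` EQUAL to the given ones. [cite: Balaban1985UV3, Thm 2 p.272] -/
theorem AlphaInputsT3AC.OfV2At.nonempty_pkgAtV2 (h : AlphaInputsT3AC.OfV2At F 𝔠 a₀ a₁) (hc : 0 < a₀ ∧ 0 < a₁ ∧ 𝔠.B₃ * a₁ ≤ a₀)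
    (γ : ℝ) (hγ : 0 < γ) (hγ1 : γ ≤ (min 𝔠.gamma0 1) ^ 2) (K : ℕ) :
    Nonempty {p : AlphaInputsT3AC.PkgAtV2 F 𝔠 γ hγ hγ1 K // p.a₀ = a₀ ∧ p.a₁ = a₁} := by
  obtain ⟨reg, Uk, UkH, hU0, hUs, 𝔖, 𝔄, hR, hM, hT⟩ := h γ hγ hγ1 K
  exact ⟨⟨⟨⟨reg, Uk, UkH, hU0, hUs, 𝔖, 𝔄, hR⟩, a₀, a₁, hc, hM, hT⟩, rfl, rfl⟩⟩

/-- **THE v2 RECORD AT GIVEN CONSTANTS, CHOSEN** — its `a₀`, `a₁` ARE the given ones (`pkgAtV2_a₀`/`pkgAtV2_a₁`), hence uniform in the family,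
`γ` and `K`; `toPkgAt` gives every v1 `PkgAt` theorem, the `PkgAtV2` projections give the rows. [cite: Balaban1985UV3, Thm 2 p.272] -/
noncomputable def AlphaInputsT3AC.OfV2At.pkgAtV2 (h : AlphaInputsT3AC.OfV2At F 𝔠 a₀ a₁) (hc : 0 < a₀ ∧ 0 < a₁ ∧ 𝔠.B₃ * a₁ ≤ a₀)
    (γ : ℝ) (hγ : 0 < γ) (hγ1 : γ ≤ (min 𝔠.gamma0 1) ^ 2) (K : ℕ) :
    AlphaInputsT3AC.PkgAtV2 F 𝔠 γ hγ hγ1 K :=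
  (Classical.choice (h.nonempty_pkgAtV2 hc γ hγ hγ1 K)).1

/-- The chosen record's `a₀` is the given `a₀`. [cite: Balaban1985Variational, Thm 1 (8) p.279] -/
theorem AlphaInputsT3AC.OfV2At.pkgAtV2_a₀ (h : AlphaInputsT3AC.OfV2At F 𝔠 a₀ a₁) (hc : 0 < a₀ ∧ 0 < a₁ ∧ 𝔠.B₃ * a₁ ≤ a₀)
    (γ : ℝ) (hγ : 0 < γ) (hγ1 : γ ≤ (min 𝔠.gamma0 1) ^ 2) (K : ℕ) :
    (h.pkgAtV2 hc γ hγ hγ1 K).a₀ = a₀ :=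
  (Classical.choice (h.nonempty_pkgAtV2 hc γ hγ hγ1 K)).2.1

/-- The chosen record's `a₁` is the given `a₁`. [cite: Balaban1985Variational, Thm 1 (7)-(8) p.279] -/
theorem AlphaInputsT3AC.OfV2At.pkgAtV2_a₁ (h : AlphaInputsT3AC.OfV2At F 𝔠 a₀ a₁) (hc : 0 < a₀ ∧ 0 < a₁ ∧ 𝔠.B₃ * a₁ ≤ a₀)
    (γ : ℝ) (hγ : 0 < γ) (hγ1 : γ ≤ (min 𝔠.gamma0 1) ^ 2) (K : ℕ) :
    (h.pkgAtV2 hc γ hγ hγ1 K).a₁ = a₁ :=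
  (Classical.choice (h.nonempty_pkgAtV2 hc γ hγ hγ1 K)).2.2

end Pkg

end Summit.QuantumFields.YangMills.Theorems

end
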